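import Mathlib
import Literature.Computability.AlgebraicComplexity.TensorRestrictionRank
import Literature.Computability.AlgebraicComplexity.WaringRankTrCubeProofs
import Summits.MatrixMultiplication.MatrixMultiplication.Theses.WindowedCompletionRank

/-!
# `WindowedCompletionRank.DelegationBound` — the delegation completion (item 5502)

Item `stmt-MatrixMultiplication-5502` (support of route `WindowedCompletionRank`): for every `m ≥ 1`,
with `n = m³` and `G = ℤ_n²`, there is a tensor `S` on `G³` which

* satisfies the full-window constraint `S(p+q; p, q) = [p₂ + q₁ = 0]`,
* is invariant under the translations `(g,p,q) ↦ (g+u+v, p+u, q+v)` with `u₂ + v₁ = 0`, and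
* has `R(S) ≤ R(⟨m,m,m⟩)`.

## The construction (planner's "delegation": Fourier side `(1/n)·⟨m,m,m⟩` on the digit tiling)

Let `ψ` be the standard additive character of `ℤ_n` and let `X, Z, Y : [m] → ℤ_n` be the digit
places `X κ = κ`, `Z μ = m·μ`, `Y ν = m²·ν`, so that `(κ, μ, ν) ↦ X κ + Z μ + Y ν` is a bijection
`[m]³ ≃ ℤ_n` (base-`m` digits).  Put
`S(g; p, q) = (1/n) ∑_{κ,μ,ν} ψ(Xκ·g₁ + Yν·g₂) · ψ(−Xκ·p₁ + (Xκ+Zμ)·p₂) · ψ((Yν+Zμ)·q₁ − Yν·q₂)`.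
The three factors depend on `(κ,ν)`, `(κ,μ)`, `(μ,ν)` respectively, i.e. `S` is the image of
`⟨m,m,m⟩ = ∑ e_{κν} ⊗ e_{κμ} ⊗ e_{μν}` under three linear maps — a restriction — so
`R(S) ≤ R(⟨m,m,m⟩)` (`TensorRestrictsTo.tensorRank_le`).  On the window `g = p + q` the exponent
collapses to `(Xκ + Yν + Zμ)·(p₂ + q₁)`, and by the tiling and character orthogonality
`(1/n) ∑_{τ ∈ ℤ_n} ψ(τ s) = [s = 0]`.  Under a translation with `u₂ + v₁ = 0` the exponent changes
by `(Xκ + Yν + Zμ)·(u₂ + v₁) = 0`.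

The witness is produced inside `exists_windowCompletion_of_tiling`, stated for any finite
commutative ring `R` with a primitive additive character and any tiling `X + Z + Y` of `R` by
three `m`-sets; the item is the instance `R = ZMod (m^3)` with the base-`m` digit tiling
(`digitPlaces_bijective`).  No definitions are declared and no named fact is used.
-/

-- `Summit.<Summit>.<Problem>` is the tree's mandated summit-side namespace; for this
-- single-conjunct summit the two coincide, so the file silences `dupNamespace`.
set_option linter.dupNamespace false

noncomputable section

open scoped BigOperators

namespace Summit.MatrixMultiplication.MatrixMultiplication.Theorems

open Literature.Computability.AlgebraicComplexity

/-- **Windowed completions from tilings.**  Let `R` be a finite commutative ring with a primitive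
additive character `ψ`, and let `X, Y, Z : [m] → R` be such that `(κ, μ, ν) ↦ X κ + Z μ + Y ν` is a
bijection `[m]³ → R` (a tiling `X + Z + Y = R`).  Then the tensor
`S(g; p, q) = |R|⁻¹ ∑_{κ,μ,ν} ψ(Xκ·g₁ + Yν·g₂) ψ(−Xκ·p₁ + (Xκ+Zμ)·p₂) ψ((Yν+Zμ)·q₁ − Yν·q₂)` on `(R²)³`
satisfies the full-window constraint `S(p+q; p, q) = [p₂ + q₁ = 0]`, is invariant under
`(g,p,q) ↦ (g+u+v, p+u, q+v)` for `u₂ + v₁ = 0`, and — being a restriction of `⟨m,m,m⟩` — has rank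
at most `R(⟨m,m,m⟩)`. -/
theorem exists_windowCompletion_of_tiling {R : Type*} [CommRing R] [Fintype R] [DecidableEq R]
    {m : ℕ} (ψ : AddChar R ℂ) (hψ : ψ.IsPrimitive) (X Y Z : Fin m → R)
    (hd : Function.Bijective fun x : Fin m × Fin m × Fin m => X x.1 + Z x.2.1 + Y x.2.2) :
    ∃ S : R × R → R × R → R × R → ℂ,
      (∀ p q : R × R, S (p + q) p q = if p.2 + q.1 = 0 then 1 else 0) ∧
      (∀ g p q u v : R × R, u.2 + v.1 = 0 → S (g + (u + v)) (p + u) (q + v) = S g p q) ∧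
      tensorRank S ≤ tensorRank (matMulTensor ℂ m m m) := by
  -- the normalisation and the three legs of the restriction
  obtain ⟨N, hN⟩ : ∃ N : ℂ, N = (Fintype.card R : ℂ) := ⟨_, rfl⟩
  obtain ⟨A, hA⟩ : ∃ A : R × R → Fin m × Fin m → ℂ,
      A = fun g a => N⁻¹ * ψ (X a.1 * g.1 + Y a.2 * g.2) := ⟨_, rfl⟩
  obtain ⟨B, hB⟩ : ∃ B : R × R → Fin m × Fin m → ℂ,
      B = fun p b => ψ (-(X b.1 * p.1) + (X b.1 + Z b.2) * p.2) := ⟨_, rfl⟩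
  obtain ⟨C, hC⟩ : ∃ C : R × R → Fin m × Fin m → ℂ,
      C = fun q c => ψ ((Y c.2 + Z c.1) * q.1 - Y c.2 * q.2) := ⟨_, rfl⟩
  obtain ⟨S, hS⟩ : ∃ S : R × R → R × R → R × R → ℂ,
      S = fun g p q => ∑ a, ∑ b, ∑ c, A g a * B p b * C q c * matMulTensor ℂ m m m a b c :=
    ⟨_, rfl⟩
  -- `S` is a restriction of `⟨m,m,m⟩` by construction
  have hres : TensorRestrictsTo (matMulTensor ℂ m m m) S := ⟨A, B, C, fun g p q => by rw [hS]⟩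
  -- explicit form: one character value per term of `⟨m,m,m⟩`
  have hsum : ∀ g p q : R × R, S g p q = ∑ x : Fin m × Fin m × Fin m,
      N⁻¹ * ψ (X x.1 * g.1 + Y x.2.2 * g.2 + (-(X x.1 * p.1) + (X x.1 + Z x.2.1) * p.2)
        + ((Y x.2.2 + Z x.2.1) * q.1 - Y x.2.2 * q.2)) := by
    intro g p q
    have h1 : S g p q = ∑ a, ∑ b, ∑ c, matMulTensor ℂ m m m a b c * (A g a * B p b * C q c) := by
      rw [hS]
      exact Finset.sum_congr rfl fun a _ => Finset.sum_congr rfl fun b _ =>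
        Finset.sum_congr rfl fun c _ => mul_comm _ _
    rw [h1, sum_matMulTensor_mul]
    simp only [Fintype.sum_prod_type]
    refine Finset.sum_congr rfl fun κ _ => Finset.sum_congr rfl fun μ _ =>
      Finset.sum_congr rfl fun ν _ => ?_
    rw [hA, hB, hC]
    simp only [AddChar.map_add_eq_mul]
    ring
  refine ⟨S, fun p q => ?_, fun g p q u v huv => ?_, hres.tensorRank_le⟩
  · -- the window constraint: the exponent collapses to `(Xκ + Zμ + Yν)·(p₂ + q₁)`
    have hterm : ∀ x : Fin m × Fin m × Fin m,
        N⁻¹ * ψ (X x.1 * (p + q).1 + Y x.2.2 * (p + q).2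
          + (-(X x.1 * p.1) + (X x.1 + Z x.2.1) * p.2)
          + ((Y x.2.2 + Z x.2.1) * q.1 - Y x.2.2 * q.2))
        = N⁻¹ * ψ ((X x.1 + Z x.2.1 + Y x.2.2) * (p.2 + q.1)) := by
      intro x
      refine congrArg (fun t => N⁻¹ * ψ t) ?_
      simp only [Prod.fst_add, Prod.snd_add]
      ring
    have hc := hd.sum_comp (fun τ => ψ (τ * (p.2 + q.1)))
    beta_reduce at hc
    rw [hsum]
    simp only [hterm]
    rw [← Finset.mul_sum, hc, AddChar.sum_mulShift _ hψ]
    have hN0 : N ≠ 0 := by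
      rw [hN]
      exact Nat.cast_ne_zero.2 Fintype.card_ne_zero
    split_ifs
    · rw [← hN]
      exact inv_mul_cancel₀ hN0
    · rw [Nat.cast_zero, mul_zero]
  · -- translation invariance: the exponent changes by `(Xκ + Zμ + Yν)·(u₂ + v₁) = 0`
    rw [hsum, hsum]
    refine Finset.sum_congr rfl fun x _ => ?_
    refine congrArg (fun t => N⁻¹ * ψ t) ?_
    simp only [Prod.fst_add, Prod.snd_add]
    linear_combination (X x.1 + Z x.2.1 + Y x.2.2) * huv

/-- **Base-`m` digits tile `ℤ_{m³}`**: the map `(κ, μ, ν) ↦ κ + m·μ + m²·ν` is a bijection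
`[m]³ → ZMod (m^3)` (`m ≥ 1`).  Proof: it is onto (read off the digits of `τ.val < m³` with
`Nat.mod_add_div`) and both sides have `m³` elements. -/
theorem digitPlaces_bijective (m : ℕ) [NeZero m] :
    Function.Bijective fun x : Fin m × Fin m × Fin m =>
      ((x.1 : ℕ) : ZMod (m ^ 3)) + (m : ZMod (m ^ 3)) * ((x.2.1 : ℕ) : ZMod (m ^ 3))
        + (m : ZMod (m ^ 3)) * (m : ZMod (m ^ 3)) * ((x.2.2 : ℕ) : ZMod (m ^ 3)) := by
  rw [Fintype.bijective_iff_surjective_and_card]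
  refine ⟨fun τ => ?_, by simp [Fintype.card_prod, ZMod.card, pow_three]⟩
  have hm : 0 < m := Nat.pos_of_ne_zero (NeZero.ne m)
  obtain ⟨t, ht, rfl⟩ : ∃ t : ℕ, t < m ^ 3 ∧ (t : ZMod (m ^ 3)) = τ :=
    ⟨τ.val, τ.val_lt, ZMod.natCast_zmod_val τ⟩
  have hν : t / m / m < m := by
    rw [Nat.div_lt_iff_lt_mul hm, Nat.div_lt_iff_lt_mul hm]
    calc t < m ^ 3 := ht
      _ = m * m * m := by ring
  refine ⟨(⟨t % m, Nat.mod_lt _ hm⟩, ⟨(t / m) % m, Nat.mod_lt _ hm⟩, ⟨t / m / m, hν⟩), ?_⟩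
  have key : t % m + m * ((t / m) % m) + m * m * (t / m / m) = t := by
    have h1 := Nat.mod_add_div t m
    have h2 := Nat.mod_add_div (t / m) m
    calc t % m + m * ((t / m) % m) + m * m * (t / m / m)
        = t % m + m * ((t / m) % m + m * (t / m / m)) := by ring
      _ = t := by rw [h2, h1]
  show ((t % m : ℕ) : ZMod (m ^ 3)) + (m : ZMod (m ^ 3)) * ((t / m % m : ℕ) : ZMod (m ^ 3))
      + (m : ZMod (m ^ 3)) * (m : ZMod (m ^ 3)) * ((t / m / m : ℕ) : ZMod (m ^ 3))
      = (t : ZMod (m ^ 3))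
  have hcast : ((t % m : ℕ) : ZMod (m ^ 3)) + (m : ZMod (m ^ 3)) * ((t / m % m : ℕ) : ZMod (m ^ 3))
      + (m : ZMod (m ^ 3)) * (m : ZMod (m ^ 3)) * ((t / m / m : ℕ) : ZMod (m ^ 3))
      = ((t % m + m * ((t / m) % m) + m * m * (t / m / m) : ℕ) : ZMod (m ^ 3)) := by
    push_cast
    ring
  rw [hcast, key]

/-- **Item `stmt-MatrixMultiplication-5502` (`DelegationBound`).**  For every `m ≥ 1` there is a
tensor `S` on `(ZMod (m^3) × ZMod (m^3))³` satisfying the `ℤ_n²` full-window constraint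
`S(p+q; p, q) = [p₂ + q₁ = 0]`, invariant under the translations `(g,p,q) ↦ (g+u+v, p+u, q+v)`,
`u₂ + v₁ = 0`, with `R(S) ≤ R(⟨m,m,m⟩)`: the delegation completion of
`exists_windowCompletion_of_tiling` for the standard character of `ZMod (m^3)` and the base-`m`
digit tiling `digitPlaces_bijective` (so `c ≤ 7` at `n = 8`, and in general cost
`n²·R(⟨n^{1/3}⟩)`). -/
theorem delegationBound_proof :
    Summit.MatrixMultiplication.MatrixMultiplication.Theses.WindowedCompletionRank.DelegationBound := by
  unfold Summit.MatrixMultiplication.MatrixMultiplication.Theses.WindowedCompletionRank.DelegationBound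
  intro m hm
  haveI : NeZero m := ⟨by omega⟩
  obtain ⟨S, h1, h2, h3⟩ := exists_windowCompletion_of_tiling (m := m)
    (ZMod.stdAddChar (N := m ^ 3)) (ZMod.isPrimitive_stdAddChar (m ^ 3))
    (fun κ => ((κ : ℕ) : ZMod (m ^ 3)))
    (fun ν => (m : ZMod (m ^ 3)) * (m : ZMod (m ^ 3)) * ((ν : ℕ) : ZMod (m ^ 3)))
    (fun μ => (m : ZMod (m ^ 3)) * ((μ : ℕ) : ZMod (m ^ 3)))
    (digitPlaces_bijective m)
  exact ⟨S, h1, h2, h3⟩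

end Summit.MatrixMultiplication.MatrixMultiplication.Theorems
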